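import Literature.MeasureTheory.Covering.KrylovSafonovGrowth
import Mathlib.Analysis.SpecialFunctions.Pow.Integral
import Mathlib.Analysis.SpecialFunctions.ImproperIntegrals
import Mathlib.Analysis.SpecialFunctions.Pow.Continuity
import HarnessLib

/-!
# From the growth lemma to the `Lᵖ` bound (Gilbarg–Trudinger (9.59) ⇒ (9.60) ⇒ (9.61))

On the unit cube `K₀`, suppose `w` satisfies the conclusion (9.59) of Lemma 9.23 with constants
`0 < δ < 1`, `C > 0`. For `g = e^{-w}` this gives the **distribution-function bound** (9.60)
`|{g ≥ t} ∩ K₀| ≤ δ⁻¹ (g(x)/t)^κ`, `κ = log(1/δ)/C`, for every `x ∈ K₀`, `t > 0`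
(`volume_superlevel_le`), and then by the layer-cake formula the **`Lᵖ` bound** (9.61)
`∫_{K₀} g^p ≤ (1 + p/(δ(κ-p))) g(x)^p` for `0 < p < κ` (`lintegral_rpow_exp_neg_le`).

## References

* D. Gilbarg, N. S. Trudinger, *Elliptic Partial Differential Equations of Second Order* (2001),
  proof of Theorem 9.22, (9.59)–(9.61) (with Lemma 9.7 = layer cake). [GilbargTrudinger2001]
-/

noncomputable section

open Set MeasureTheory Filter
open scoped ENNReal Topology

namespace Literature.MeasureTheory.Covering.Dyadic

variable {ι : Type*} [Fintype ι]

/-- The exponent `κ = -log δ / C = log(1/δ)/C`. [cite: GilbargTrudinger2001, (9.60)] -/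
def kappa (δ C : ℝ) : ℝ := -Real.log δ / C

/-- `κ > 0`. [folklore] -/
theorem kappa_pos {δ C : ℝ} (hδ0 : 0 < δ) (hδ1 : δ < 1) (hC : 0 < C) : 0 < kappa δ C :=
  div_pos (neg_pos.2 (Real.log_neg hδ0 hδ1)) hC

/-- **(9.60), the distribution-function bound.** If (9.59) holds for `w` on `K₀`, then for
`g = e^{-w}`, every `x ∈ K₀` and `t > 0`:
`|K₀ ∩ {g ≥ t}| ≤ δ⁻¹ (g x / t)^κ`. [cite: GilbargTrudinger2001, proof of Thm 9.22, (9.60)] -/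
theorem volume_superlevel_le {w : (ι → ℝ) → ℝ} {δ C : ℝ} (hδ0 : 0 < δ) (hδ1 : δ < 1) (hC : 0 < C)
    (H59 : ∀ k : ℝ, 0 < volume (subLevel w k) → ∀ x ∈ dyadicCube (ι := ι) 0 0,
      w x - k ≤ C * (1 + Real.log (volume (subLevel w k)).toReal / Real.log δ))
    {x : ι → ℝ} (hx : x ∈ dyadicCube (ι := ι) 0 0) {t : ℝ} (ht : 0 < t) :
    (volume (dyadicCube (ι := ι) 0 0 ∩ {s | t ≤ Real.exp (-w s)})).toReal ≤
      δ⁻¹ * (Real.exp (-w x) / t) ^ kappa δ C := by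
  set k := -Real.log t with hk
  have hset : dyadicCube (ι := ι) 0 0 ∩ {s | t ≤ Real.exp (-w s)} = subLevel w k := by
    ext s
    simp only [subLevel, mem_inter_iff, mem_setOf_eq, hk]
    refine and_congr_right fun _ ↦ ?_
    rw [← Real.exp_log ht, Real.exp_le_exp, Real.exp_log ht]
    constructor <;> intro h <;> linarith
  rw [hset]
  have hRHS0 : 0 ≤ δ⁻¹ * (Real.exp (-w x) / t) ^ kappa δ C := by positivity
  by_cases hV : volume (subLevel w k) = 0
  · rw [hV, ENNReal.toReal_zero]; exact hRHS0
  have hVpos : 0 < volume (subLevel w k) := pos_iff_ne_zero.2 hV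
  have hVfin : volume (subLevel w k) ≠ ∞ := ne_top_of_le_ne_top ENNReal.one_ne_top (volume_subLevel_le_one w k)
  set V := (volume (subLevel w k)).toReal with hVdef
  have hV0 : 0 < V := ENNReal.toReal_pos hV hVfin
  have hlogδ : Real.log δ < 0 := Real.log_neg hδ0 hδ1
  have h := H59 k hVpos x hx
  -- `log V ≤ log δ · ((w x - k)/C - 1)`
  have h1 : (w x - k) / C - 1 ≤ Real.log V / Real.log δ := by
    have : (w x - k) / C ≤ 1 + Real.log V / Real.log δ := by
      rw [div_le_iff₀ hC]; linarith
    linarith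
  have h2 : Real.log V ≤ Real.log δ * ((w x - k) / C - 1) := by
    have := mul_le_mul_of_nonpos_left h1 hlogδ.le
    rwa [mul_div_cancel₀ _ hlogδ.ne] at this
  have h3 : V ≤ Real.exp (Real.log δ * ((w x - k) / C - 1)) := by
    rw [← Real.exp_log hV0]; exact Real.exp_le_exp.2 h2
  refine h3.trans (le_of_eq ?_)
  -- `exp(log δ ((w x - k)/C - 1)) = δ⁻¹ (e^{-w x}/t)^κ`
  rw [show Real.log δ * ((w x - k) / C - 1) = (-w x - Real.log t) * kappa δ C + -Real.log δ by
    rw [kappa, hk]; field_simp; ring]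
  rw [Real.exp_add, Real.exp_neg, Real.exp_log hδ0, Real.exp_mul, mul_comm]
  congr 1
  rw [Real.exp_sub, Real.exp_log ht]

/-- (9.60) in `ℝ≥0∞` form. [cite: GilbargTrudinger2001, (9.60)] -/
theorem volume_superlevel_le' {w : (ι → ℝ) → ℝ} {δ C : ℝ} (hδ0 : 0 < δ) (hδ1 : δ < 1) (hC : 0 < C)
    (H59 : ∀ k : ℝ, 0 < volume (subLevel w k) → ∀ x ∈ dyadicCube (ι := ι) 0 0,
      w x - k ≤ C * (1 + Real.log (volume (subLevel w k)).toReal / Real.log δ))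
    {x : ι → ℝ} (hx : x ∈ dyadicCube (ι := ι) 0 0) {t : ℝ} (ht : 0 < t) :
    volume (dyadicCube (ι := ι) 0 0 ∩ {s | t ≤ Real.exp (-w s)}) ≤
      ENNReal.ofReal (δ⁻¹ * (Real.exp (-w x) / t) ^ kappa δ C) := by
  have hfin : volume (dyadicCube (ι := ι) 0 0 ∩ {s | t ≤ Real.exp (-w s)}) ≠ ∞ :=
    ne_top_of_le_ne_top ENNReal.one_ne_top ((measure_mono inter_subset_left).trans
      (by rw [volume_dyadicCube]; simp))
  rw [← ENNReal.ofReal_toReal hfin]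
  exact ENNReal.ofReal_le_ofReal (volume_superlevel_le hδ0 hδ1 hC H59 hx ht)

/-- **(9.61), the `Lᵖ` bound by layer cake**: for `0 < p < κ` and every `x ∈ K₀`,
`∫_{K₀} (e^{-w})^p ≤ (1 + p/(δ(κ-p))) (e^{-w(x)})^p`.
[cite: GilbargTrudinger2001, proof of Thm 9.22, (9.61) (via Lemma 9.7)] -/
theorem lintegral_rpow_exp_neg_le {w : (ι → ℝ) → ℝ} (hw : Measurable w) {δ C : ℝ} (hδ0 : 0 < δ)
    (hδ1 : δ < 1) (hC : 0 < C)
    (H59 : ∀ k : ℝ, 0 < volume (subLevel w k) → ∀ x ∈ dyadicCube (ι := ι) 0 0,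
      w x - k ≤ C * (1 + Real.log (volume (subLevel w k)).toReal / Real.log δ))
    {x : ι → ℝ} (hx : x ∈ dyadicCube (ι := ι) 0 0) {p : ℝ} (hp0 : 0 < p) (hpκ : p < kappa δ C) :
    ∫⁻ s in dyadicCube (ι := ι) 0 0, ENNReal.ofReal (Real.exp (-w s) ^ p) ≤
      ENNReal.ofReal ((1 + p / (δ * (kappa δ C - p))) * Real.exp (-w x) ^ p) := by
  set K₀ := dyadicCube (ι := ι) 0 0 with hK₀
  set κ := kappa δ C with hκ
  set g : (ι → ℝ) → ℝ := fun s ↦ Real.exp (-w s) with hg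
  set M := g x with hM
  have hM0 : 0 < M := Real.exp_pos _
  have hK₀m : MeasurableSet K₀ := measurableSet_dyadicCube 0 0
  have hK₀vol : volume K₀ = 1 := by rw [hK₀, volume_dyadicCube]; simp
  set μ : Measure (ι → ℝ) := volume.restrict K₀ with hμ
  have hgm : Measurable g := Real.measurable_exp.comp hw.neg
  -- layer cake
  have hlc := MeasureTheory.lintegral_rpow_eq_lintegral_meas_lt_mul μ (f := g)
    (Eventually.of_forall fun s ↦ (Real.exp_pos _).le) hgm.aemeasurable hp0
  rw [hlc]
  -- pointwise bound of the integrand on `(0, ∞)`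
  set F₁ : ℝ → ℝ≥0∞ := fun t ↦ ENNReal.ofReal (t ^ (p - 1)) with hF₁
  set F₂ : ℝ → ℝ≥0∞ := fun t ↦ ENNReal.ofReal (δ⁻¹ * M ^ κ * t ^ (p - 1 - κ)) with hF₂
  have hptw : ∀ t ∈ Ioi (0 : ℝ), μ {a | t < g a} * ENNReal.ofReal (t ^ (p - 1)) ≤
      (Ioc 0 M).indicator F₁ t + (Ioi M).indicator F₂ t := by
    intro t ht
    have ht0 : 0 < t := ht
    have hμt : μ {a | t < g a} = volume ({a | t < g a} ∩ K₀) := by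
      rw [hμ, Measure.restrict_apply' hK₀m]
    rcases le_or_gt t M with htM | htM
    · have hmem : t ∈ Ioc (0 : ℝ) M := ⟨ht0, htM⟩
      rw [indicator_of_mem hmem]
      have h1 : μ {a | t < g a} ≤ 1 := by
        rw [hμt, ← hK₀vol]; exact measure_mono inter_subset_right
      calc μ {a | t < g a} * ENNReal.ofReal (t ^ (p - 1)) ≤ 1 * ENNReal.ofReal (t ^ (p - 1)) :=
            mul_le_mul_left h1 _
        _ = F₁ t := one_mul _
        _ ≤ F₁ t + (Ioi M).indicator F₂ t := le_self_add
    · have hmem : t ∈ Ioi M := htM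
      have hnot : t ∉ Ioc (0 : ℝ) M := fun h ↦ absurd h.2 (not_le.2 htM)
      rw [indicator_of_mem hmem, indicator_of_notMem hnot, zero_add]
      have h60 := volume_superlevel_le' hδ0 hδ1 hC H59 hx ht0
      have h1 : μ {a | t < g a} ≤ ENNReal.ofReal (δ⁻¹ * (M / t) ^ κ) := by
        rw [hμt, inter_comm]
        exact (measure_mono (inter_subset_inter_right _ fun a (ha : t < g a) ↦ ha.le)).trans h60
      calc μ {a | t < g a} * ENNReal.ofReal (t ^ (p - 1))
          ≤ ENNReal.ofReal (δ⁻¹ * (M / t) ^ κ) * ENNReal.ofReal (t ^ (p - 1)) := mul_le_mul_left h1 _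
        _ = F₂ t := by
            rw [hF₂, ← ENNReal.ofReal_mul (by positivity)]
            congr 1
            rw [Real.div_rpow hM0.le ht0.le, show p - 1 - κ = (p - 1) + (-κ) by ring,
              Real.rpow_add ht0, Real.rpow_neg ht0.le]
            field_simp
  -- integrate the bound
  have hF₁m : Measurable F₁ := ENNReal.measurable_ofReal.comp (measurable_id.pow_const _)
  have hI : ∫⁻ t in Ioi 0, μ {a | t < g a} * ENNReal.ofReal (t ^ (p - 1)) ≤
      (∫⁻ t in Ioc 0 M, F₁ t) + ∫⁻ t in Ioi M, F₂ t := by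
    calc ∫⁻ t in Ioi 0, μ {a | t < g a} * ENNReal.ofReal (t ^ (p - 1))
        ≤ ∫⁻ t in Ioi 0, ((Ioc 0 M).indicator F₁ t + (Ioi M).indicator F₂ t) :=
          setLIntegral_mono' measurableSet_Ioi hptw
      _ = (∫⁻ t in Ioi 0, (Ioc 0 M).indicator F₁ t) + ∫⁻ t in Ioi 0, (Ioi M).indicator F₂ t :=
          lintegral_add_left (hF₁m.indicator measurableSet_Ioc) _
      _ = (∫⁻ t in Ioc 0 M, F₁ t) + ∫⁻ t in Ioi M, F₂ t := by
          rw [setLIntegral_indicator measurableSet_Ioc, setLIntegral_indicator measurableSet_Ioi,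
            inter_eq_left.2 (Ioc_subset_Ioi_self), inter_eq_left.2 (Ioi_subset_Ioi hM0.le)]
  -- the two explicit integrals
  have hI₁ : ∫⁻ t in Ioc 0 M, F₁ t = ENNReal.ofReal (M ^ p / p) := by
    have hint : IntegrableOn (fun t : ℝ ↦ t ^ (p - 1)) (Ioc 0 M) :=
      (intervalIntegral.intervalIntegrable_rpow' (by linarith : -1 < p - 1)).def'.mono_set
        (by rw [uIoc_of_le hM0.le])
    have hnn : 0 ≤ᵐ[volume.restrict (Ioc 0 M)] fun t : ℝ ↦ t ^ (p - 1) := by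
      filter_upwards [ae_restrict_mem measurableSet_Ioc] with t ht
      exact Real.rpow_nonneg ht.1.le _
    rw [hF₁, ← ofReal_integral_eq_lintegral_ofReal hint hnn, ← intervalIntegral.integral_of_le hM0.le,
      integral_rpow (Or.inl (by linarith : -1 < p - 1))]
    congr 1
    rw [show p - 1 + 1 = p by ring, Real.zero_rpow hp0.ne', sub_zero]
  have hI₂ : ∫⁻ t in Ioi M, F₂ t = ENNReal.ofReal (δ⁻¹ * M ^ p / (κ - p)) := by
    have ha : p - 1 - κ < -1 := by linarith
    have hint : IntegrableOn (fun t : ℝ ↦ t ^ (p - 1 - κ)) (Ioi M) := integrableOn_Ioi_rpow_of_lt ha hM0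
    have hnn : 0 ≤ᵐ[volume.restrict (Ioi M)] fun t : ℝ ↦ t ^ (p - 1 - κ) := by
      filter_upwards [ae_restrict_mem measurableSet_Ioi] with t ht
      exact Real.rpow_nonneg (hM0.trans ht).le _
    have hc : 0 ≤ δ⁻¹ * M ^ κ := by positivity
    have e1 : ∀ t, F₂ t = ENNReal.ofReal (δ⁻¹ * M ^ κ) * ENNReal.ofReal (t ^ (p - 1 - κ)) := fun t ↦ by
      rw [hF₂, ← ENNReal.ofReal_mul hc]
    simp_rw [e1]
    rw [lintegral_const_mul _ (by fun_prop), ← ofReal_integral_eq_lintegral_ofReal hint hnn,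
      integral_Ioi_rpow_of_lt ha hM0, ← ENNReal.ofReal_mul hc]
    congr 1
    rw [show p - 1 - κ + 1 = p - κ by ring]
    have hMκ : M ^ κ * M ^ (p - κ) = M ^ p := by
      rw [← Real.rpow_add hM0]; ring_nf
    have hκp : κ - p ≠ 0 := by linarith
    have hpκ' : p - κ ≠ 0 := by linarith
    field_simp
    rw [← hMκ]
    ring
  calc ENNReal.ofReal p * ∫⁻ t in Ioi 0, μ {a | t < g a} * ENNReal.ofReal (t ^ (p - 1))
      ≤ ENNReal.ofReal p * ((∫⁻ t in Ioc 0 M, F₁ t) + ∫⁻ t in Ioi M, F₂ t) := mul_le_mul_right hI _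
    _ = ENNReal.ofReal ((1 + p / (δ * (κ - p))) * M ^ p) := by
        rw [hI₁, hI₂, ← ENNReal.ofReal_add (by positivity) (by
              have : 0 < κ - p := by linarith
              positivity),
          ← ENNReal.ofReal_mul hp0.le]
        congr 1
        have hκp : κ - p ≠ 0 := by linarith
        field_simp

end Literature.MeasureTheory.Covering.Dyadic

end
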